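import Summits.BirchSwinnertonDyer.BirchSwinnertonDyer.Theorems.RamifiedHeegnerPairRamifiedPairUpperBoundRankOneMember
import HarnessLib

/-!
# Route `RamifiedHeegnerPair`, crux X2 `RamifiedPairUpperBound` (stmt-BirchSwinnertonDyer-23192), skeleton v4 —
# the OPEN CORE `stub_leafRankOneUpper` on the 3-adic-tower rows, from GLOBAL DIVISIBILITY of the derived
# Heegner points over a SPLIT Heegner field (Jetchev's Σ-form = the tree's RKC₃ divisibility) + the twist's
# rank-zero lower half — the Gss2 analogue of the cell's wild-row theorem

HONEST FRAMING. Theorems only; helper file (`--supports stmt-BirchSwinnertonDyer-23192 --as helper`); nothing is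
booked, no item is closed, BSD is not proved for any curve; CONDITIONAL on every displayed input. Skeleton v4
(`Cruxes/RamifiedPairUpperBound/Lines/birth.lean`, afb2fcab) has ONE open core, `stub_leafRankOneUpper`: the
Euler-system half `ord₃ #Ш(E) ≤ ord₃ #Ш_an(E)` for the non-CM Gss2-at-3 curves of analytic rank one. The file
`…RankOneMember.lean` (p606327) reduced it, over a SPLIT Heegner field `K′`, to the cell's Kolyvagin-side socket
`SchneiderFree.Upper.IndexUpperBoundLeAt W 3 K′ P (v₃ c)` + the rank-zero twist's lower half, and discharged the
socket from print on the tam-free rows. Here the socket is fed, on the rows with `ρ_{E,3^n}` onto for every `n`,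
by the cell's RECEPTACLE `SchneiderFree.Exact.upper_of_globalDivisibility` (UTD, Theses-free): GLOBAL
`3^{s′}`-DIVISIBILITY of the derived Heegner points `P_n` on the frame `(Dt, H.β, ι)` for every
`s′ ≤ ord₃ ∏_ℓ c_ℓ(E) + v₃(c)` (`Koly.PDiv`; DISPLAYED research input = Jetchev 2008 Conj. 1.3, divisibility
half, READ at an additive `3` — the tree's `AdditiveThree.RKC3Divisibility` up to the Manin slack; NOT in print at
`p ∣ N`) + McCallum 1991 Cor. 5.6 upper form (named fact `McCallum1991_padicValNat_card_sha_primary_add_le_of_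
globalDivisibility`, hypothesis). So:

* `leafRankOneUpper_three_of_globalDivisibility_of_twistLower_on_tower_rows` — for `W` additive at `3`,
  `r_an(W) = 1`, `ρ_{W,3^n}` onto (all `n`), ONE split Heegner datum with odd `d_{K′}`, `L(W^{(d_{K′})},1) ≠ 0`:
  global divisibility to depth `ord₃ ∏_ℓ c_ℓ(W) + v₃(c)` + `Typed.MissingLowerBoundAt Wd 3` for the rank-ZERO
  twist (again Gss2) + the named facts ⟹ `Typed.MissingUpperBoundAt W 3`;
* `jointUpperBoundAt_rankOne_of_globalDivisibility_of_twistLower_of_prop48` — plus Perrin-Riou 2003 Prop. 4.8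
  for the good supersingular rank-zero partner `V` (`surj(9)`) ⟹ X2's conclusion `JointUpperBoundAt W V 3` at
  `(W, V, d)`.

This is the Gss2 row's counterpart of `SchneiderFree.Exact.bsdp_three_of_indexEqTamagawaManin_of_globalDivisibility_
of_wAllExclAddWildRankZero` (wild row, leaf #6 pays the twist): on the Gss2 row the twist's half is X1's rank-zero
member content. Census (lead's audit X2-ENGINE-AUDIT.md §3): the research input is load-bearing on 238 + 108 of
the 355 residual rank-one Gss2 classes (≥ 2 resp. 1 Tamagawa `3`), idle on the 9 tam-free ones (print, p606327
§3); the tower bit is outside ecdata. Lead prover bsd-line-rhp-p2 g2, 2026-08-28.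

References: [cite: McCallumLMS1991, §5 Cor. 5.6 (p. 310), Lemma 5.1 (p. 303)] [cite: Jetchev2008, Conj. 1.3,
Thm. 1.4, Cor. 1.5 (p. 812)] [cite: GrossZagier1986, Thm. I.(6.3), I.(7.3)] [cite: JetchevSkinnerWan2017, §7.4.1]
[cite: PerrinRiou2003, Prop. 4.8 (p. 162)] [cite: Miller2011LMS, Def. 1.1].
-/

-- D-0017: single-problem summit, so `Summit.BirchSwinnertonDyer.BirchSwinnertonDyer.…` repeats a namespace BY DESIGN.
set_option linter.dupNamespace false
set_option autoImplicit false

noncomputable section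

open scoped Classical

open WeierstrassCurve NumberField Literature.NumberTheory.EllipticCurves
  Literature.NumberTheory.EllipticCurves.ModularForms Literature.NumberTheory.EllipticCurves.Rank1Residual
  Literature.NumberTheory.EllipticCurves.Rank1Residual.Typed Literature.NumberTheory.EllipticCurves.KrizLi2019
  Summit.BirchSwinnertonDyer.Rank1Residual Summit.BirchSwinnertonDyer.Rank1Residual.Additive
  Summit.BirchSwinnertonDyer.Rank1Residual.X11b Summit.BirchSwinnertonDyer.Rank1Residual.X11b.Three
  Summit.BirchSwinnertonDyer.BirchSwinnertonDyer.Theorems.SchneiderFree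

namespace Summit.BirchSwinnertonDyer.BirchSwinnertonDyer.Theorems.RamifiedPairUpperBound

/-- **The open core on the tower rows from GLOBAL DIVISIBILITY + the twist's rank-zero LOWER half.** Data:
`W/ℚ` globally minimal, additive at `3`, `r_an(W) = 1`, `ρ_{W,3^n}` onto for every `n`; a Heegner datum at level
`N_E` over an imaginary quadratic `K′` with ODD `d_{K′}` satisfying the classical Heegner hypothesis (so `3`
splits: `d_{K′} ∉ {−3, −4}`), `L(W^{(d_{K′})},1) ≠ 0`, `P = y_{K′}` of `(Dt, H, ι)`, a globally minimal model `Wd`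
of the twist. NAMED FACTS (hypotheses): `hGZ`, `hKo`, `hGZK`, `hmod`, `hGZ73`, McCallum Cor. 5.6 upper form
`hMcU`. RESEARCH INPUT `hglob`: every derived Heegner point `P_n` (Kolyvagin primes of index `≥ s′`) is
`3^{s′}`-divisible for all `s′ ≤ ord₃ ∏_ℓ c_ℓ(W) + v₃(c)` (Jetchev's Σ-form at an additive `3`). TYPED INPUT
`hlow : Typed.MissingLowerBoundAt Wd 3`. OUTPUT: `Typed.MissingUpperBoundAt W 3` — `stub_leafRankOneUpper` at
`W`. (`upper_of_globalDivisibility` ⟹ the socket at slack `v₃(c)`; then p606327 §2.)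
[cite: McCallumLMS1991, §5 Cor. 5.6 (p. 310)] [cite: Jetchev2008, Conj. 1.3 and Cor. 1.5 (p. 812)]
[cite: GrossZagier1986, Thm. I.(6.3) and (7.3)] [cite: Miller2011LMS, Def. 1.1] -/
theorem leafRankOneUpper_three_of_globalDivisibility_of_twistLower_on_tower_rows
    (hGZ : ∀ (N : ℕ) [NeZero N] (W : WeierstrassCurve ℚ) (K : Type) [Field K] [NumberField K],
      gross_zagier N W K)
    (hKo : ∀ (N : ℕ) [NeZero N] (W : WeierstrassCurve ℚ) (K : Type) [Field K] [NumberField K],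
      kolyvagin N W K)
    (hGZK : rank_eq_analyticRank_of_analyticRank_le_one) (hmod : hasEntireLFunction_rat)
    (hGZ73 : GrossZagier1986_thm_I_7_3)
    (hMcU : McCallum1991_padicValNat_card_sha_primary_add_le_of_globalDivisibility)
    (W : WeierstrassCurve ℚ) [W.IsElliptic] [W.IsGloballyMinimal] [NeZero (W.conductorNorm ℤ)]
    (hadd : Addv W 3) (hr : W.analyticRank = 1) (hρ : ∀ n : ℕ, W.HasSurjectiveModNGaloisRep (3 ^ n : ℕ))
    (K : Type) [Field K] [NumberField K]
    (Dt : ModularParametrizationData W (W.conductorNorm ℤ))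
    (H : HeegnerDatum (W.conductorNorm ℤ) (NumberField.discr K)) (ι : K →+* ℂ)
    (P : (W.baseChange K).toAffine.Point) (Wd : WeierstrassCurve ℚ) [Wd.IsElliptic] [Wd.IsGloballyMinimal]
    (hK : IsImaginaryQuadratic K) (hodd : Odd (NumberField.discr K))
    (hHH : SatisfiesHeegnerHypothesis (W.conductorNorm ℤ) K)
    (hLd : (W.quadraticTwist (NumberField.discr K : ℚ)).entireLFunction 1 ≠ 0)
    (hP : WeierstrassCurve.Affine.Point.map ι.toRatAlgHom P = heegnerPointComplex Dt H)
    (hC : ∃ C : WeierstrassCurve.VariableChange ℚ, C • W.quadraticTwist (NumberField.discr K : ℚ) = Wd)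
    (hglob : ∀ (s' : ℕ), s' ≤ padicValNat 3 W.tamagawaProduct + padicValNat 3 Dt.c.natAbs →
      ∀ (n : ℕ) (d : KolyvaginHeegnerData Dt H.β ι n), Squarefree n →
        (∀ ℓ ∈ n.primeFactors, Zhang2014.IsKolyvaginPrime (W.conductorNorm ℤ) W K 3 ℓ ∧
          s' ≤ Zhang2014.kolyvaginIndex W 3 ℓ) → Koly.PDiv d 3 s')
    (hlow : MissingLowerBoundAt Wd 3) :
    MissingUpperBoundAt W 3 := by
  -- `3 ∣ N_E` splits in `K`: `d_K ≠ -3`; `d_K` odd: `d_K ≠ -4`; hence `d_K < -4`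
  have h3N : 3 ∣ W.conductorNorm ℤ :=
    (W.dvd_conductorNorm_iff_not_hasGoodReductionAtPrime 3).mpr (not_good_of_addv W 3 hadd)
  have h3 : NumberField.discr K ≠ -3 := by
    intro h
    exact (X11b.Three.not_dvd_discr_and_not_dvd_torsionOrder_of_heegner hK hHH (by decide) h3N).1
      (h ▸ ⟨-1, by norm_num⟩)
  have h4 : NumberField.discr K ≠ -4 := by
    intro h
    rw [h] at hodd
    exact (Int.not_odd_iff_even.mpr ⟨-2, by norm_num⟩) hodd
  have hd4 : NumberField.discr K < -4 := by
    haveI : IsTotallyComplex K := hK.2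
    have hneg : NumberField.discr K < 0 := WeierstrassCurve.discr_neg_of_finrank_eq_two K hK.1
    have hmod4 := Literature.NumberTheory.QuadraticFields.Quadratic.discr_emod_four (K := K) hK.1
    rcases hodd with ⟨k, hk⟩
    omega
  -- the Heegner point is non-torsion (Gross–Zagier)
  have hL0 : W.entireLFunction 1 = 0 := entireLFunction_one_eq_zero_of_analyticRank_eq_one hr
  obtain ⟨-, hderiv⟩ := leadingLCoeff_eq_deriv_of_analyticRank_eq_one hr
  have hLK : LDerivEK W K ≠ 0 := by
    rw [lDerivEK_eq_deriv_mul W K hmod hL0]; exact mul_ne_zero hderiv hLd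
  have hnt : ¬ IsOfFinAddOrder P :=
    (lDerivEK_ne_zero_iff_not_isOfFinAddOrder W (W.conductorNorm ℤ) K (hGZ _ W K) hK hHH
      ⟨Dt, H, ι, hP⟩).mp hLK
  -- the socket at slack `v₃(c)` from global divisibility (UTD receptacle), then p606327 §2
  have hup : Upper.IndexUpperBoundLeAt W 3 K P (padicValNat 3 Dt.c.natAbs) :=
    Exact.upper_of_globalDivisibility hKo hMcU W 3 (by decide) hρ K hK h3 h4 hHH Dt H ι P hP hnt hglob
  exact missingUpperBoundAt_three_of_rankOne_addv_of_upperSocket_of_twistLower hGZ hKo hGZK hmod hGZ73 W hadd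
    hr (W.conductorNorm ℤ) K Dt H ι P Wd rfl hK hodd hd4 hHH hLd hP hC hup hlow

/-- **X2's conclusion at `(W, V, d)` in orientation (1, 0) on the tower rows: global divisibility + the
twist's rank-zero lower half + print.** As above, plus the good supersingular rank-zero partner `V`
(`r_an(W) + r_an(V) = 1`, `surj(9)`) by Perrin-Riou 2003 Prop. 4.8: `JointUpperBoundAt W V 3`.
[cite: McCallumLMS1991, §5 Cor. 5.6 (p. 310)] [cite: Jetchev2008, Conj. 1.3 (p. 812)]
[cite: PerrinRiou2003, Prop. 4.8 (p. 162)] [cite: Miller2011LMS, Def. 1.1] -/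
theorem jointUpperBoundAt_rankOne_of_globalDivisibility_of_twistLower_of_prop48
    (hGZ : ∀ (N : ℕ) [NeZero N] (W : WeierstrassCurve ℚ) (K : Type) [Field K] [NumberField K],
      gross_zagier N W K)
    (hKo : ∀ (N : ℕ) [NeZero N] (W : WeierstrassCurve ℚ) (K : Type) [Field K] [NumberField K],
      kolyvagin N W K)
    (hGZK : rank_eq_analyticRank_of_analyticRank_le_one) (hmod : hasEntireLFunction_rat)
    (hGZ73 : GrossZagier1986_thm_I_7_3)
    (hMcU : McCallum1991_padicValNat_card_sha_primary_add_le_of_globalDivisibility)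
    (hPR : PerrinRiou2003.prop48_padicValRat_bsd_rank_zero_le)
    (W : WeierstrassCurve ℚ) [W.IsElliptic] [W.IsGloballyMinimal] [NeZero (W.conductorNorm ℤ)]
    (V : WeierstrassCurve ℚ) [V.IsElliptic] [V.IsGloballyMinimal]
    (hadd : Addv W 3) (hss : GoodSS V 3) (hsum : W.analyticRank + V.analyticRank = 1)
    (hr : W.analyticRank = 1) (hρ : ∀ n : ℕ, W.HasSurjectiveModNGaloisRep (3 ^ n : ℕ))
    (h9 : V.HasSurjectiveModNGaloisRep 9)
    (K : Type) [Field K] [NumberField K]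
    (Dt : ModularParametrizationData W (W.conductorNorm ℤ))
    (H : HeegnerDatum (W.conductorNorm ℤ) (NumberField.discr K)) (ι : K →+* ℂ)
    (P : (W.baseChange K).toAffine.Point) (Wd : WeierstrassCurve ℚ) [Wd.IsElliptic] [Wd.IsGloballyMinimal]
    (hK : IsImaginaryQuadratic K) (hodd : Odd (NumberField.discr K))
    (hHH : SatisfiesHeegnerHypothesis (W.conductorNorm ℤ) K)
    (hLd : (W.quadraticTwist (NumberField.discr K : ℚ)).entireLFunction 1 ≠ 0)
    (hP : WeierstrassCurve.Affine.Point.map ι.toRatAlgHom P = heegnerPointComplex Dt H)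
    (hC : ∃ C : WeierstrassCurve.VariableChange ℚ, C • W.quadraticTwist (NumberField.discr K : ℚ) = Wd)
    (hglob : ∀ (s' : ℕ), s' ≤ padicValNat 3 W.tamagawaProduct + padicValNat 3 Dt.c.natAbs →
      ∀ (n : ℕ) (d : KolyvaginHeegnerData Dt H.β ι n), Squarefree n →
        (∀ ℓ ∈ n.primeFactors, Zhang2014.IsKolyvaginPrime (W.conductorNorm ℤ) W K 3 ℓ ∧
          s' ≤ Zhang2014.kolyvaginIndex W 3 ℓ) → Koly.PDiv d 3 s')
    (hlow : MissingLowerBoundAt Wd 3) :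
    Upper.JointUpperBoundAt W V 3 :=
  jointUpperBoundAt_of_analyticRank_eq_one_of_upperW_of_prop48 hPR hGZK hmod W V hss hsum hr h9
    (leafRankOneUpper_three_of_globalDivisibility_of_twistLower_on_tower_rows hGZ hKo hGZK hmod hGZ73 hMcU W
      hadd hr hρ K Dt H ι P Wd hK hodd hHH hLd hP hC hglob hlow)

end Summit.BirchSwinnertonDyer.BirchSwinnertonDyer.Theorems.RamifiedPairUpperBound

end
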